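import Summits.BirchSwinnertonDyer.Rank1Residual.P2.CongruentNumberPairsAtTwoGenusPointData
import Summits.BirchSwinnertonDyer.Rank1Residual.P2.GenusSumsThreePrimes
import Summits.BirchSwinnertonDyer.Rank1Residual.P2.CongruentClassSevenConfigTransfer
import HarnessLib

/-!
# Sub-lane «bsd-p2»: the EVEN TWO-PRIME HALF-FAMILY `2·p₅·q`, `q ≡ 3 (mod 4)`, `(p/q) = +1` —
# `BSD(E_{2pq}, 2)` as ONE uniform theorem through U⁺ DISCHARGED (the `k = 2` slice of DOOR B6 outside
# Tian's class-`6` family; p2-lead T-113 O-1 GO)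

HONEST FRAMING (sub-lane «bsd-p2», run/shared/lean/b2b/bsd-rank1-residual/p2/, verbatim in every
file): the target of record is the FULL Birch–Swinnerton-Dyer formula for EVERY analytic-rank `≤ 1`
`E/ℚ` at ALL primes INCLUDING `2`; the odd-prime class ledger is referee A's; the `2`-part is OPEN
(cells O1 = X5 ∖ CM and O12 = the CM corner) and under census by «bsd-p2». Census / instrument
output at `2` = EVIDENCE / conjecture items with held-out validation, NEVER a Literature fact;
certificates close PAIRS (one isogeny class, `p = 2`), never classes. This file asserts NO
arithmetic fact. WHAT IT DOES. For primes `p ≡ 5 (mod 8)` and `q ≡ 3 (mod 4)` (`n = 2pq ≡ 6 (mod 8)`,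
`E_{2pq} : y² = x³ − (2pq)²x`): (i) `2p₅q₃`, `2p₅q₇` are Monsky's 1990 Cor 5.15 family (2′) (displayed fact
`h515`, lit-2 p319203: rank `1`, `#Sel₂ = 8`, `Ш[2^∞] = 0` — BOTH symbols); (ii) §1 computes, modulo
Rédei–Reichardt (`hR`), the parities of the genus class numbers entering Tian–Yuan–Zhang's PRINTED second
sum `Σ₂′(2pq)`: `g(2p)` odd; `g(pq)` EVEN when `q ≡ 3 (mod 8)` and `(p/q) = 1` (Rédei matrix `0`);
`g(2pq)` odd iff `q ≡ 3 (mod 8)` or `(p/q) = −1` (the `3 × 3` Rédei matrix of `ℚ(√−2pq)` on `(2, p, q)` is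
`(1+c, 1, c; 1, 1+a, a; c, a, c+a)`, `a = [(p/q) = −1]`, `c = [q ≡ 3 (8)]`); (iii) §2: by monsky-lit's closed
form `natCast_genusSum₂'_three` on `(2, p, q)`, `Σ₂′(2pq) ≡ g(2pq) + [q ≡ 3 (8)]·g(2)g(pq) + [q ≡ 7 (8)]·g(q)g(2p)`,
hence **`Σ₂′(2pq)` is ODD iff `(p/q) = +1`** (the `(p/q) = −1` half has `Σ₂′` EVEN — U⁺ is silent there;
p2-monsky-x second engine: parity `= [(p/q) = +1]` on all 72 221 pairs `< 3·10⁶`, EVIDENCE); (iv) §3: U⁺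
DISCHARGED (`uPlus_of_genusPointData hTYZ hGZK` = p2-monsky-lit's `W2.uPlus_genusField_of`, modulo lit-1's
displayed TYZ §3 statements `tyz_genusPointData` and GZK) gives `𝓛(2pq)` odd, `ord_{s=1} L(E_{2pq}, s) = 1`,
`L′ = 4·𝓛²·Ω·Reg` (`rankOneDatum_of_uPlus_six`, `2k − 2 = 2`), and the D-CN-5 door
`bsdp_two_congruentNumberCurve_iff_of_cor515` (no Monsky-1994 matrix; GZK enters only through U⁺) reads
`2 = ord₂ 2⁶ − 4` (Tamagawa p324736, torsion p323719 by name). CONCLUSION: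
`∀ p q prime, p ≡ 5 (mod 8) → q ≡ 3 (mod 4) → (p/q) = 1 → BSD(E_{2pq}, 2)` modulo exactly
{`tyz_genusPointData`, GZK, Rédei–Reichardt, Monsky 1990 Cor 5.15 (2′)} — nothing per-curve displayed; the
FOURTH infinite two-prime rank-one family at `2` in the tree and the first EVEN one outside Tian's class-`6`
family (`2p₀p₁`, `p₁ ≡ 1 (mod 8)`): p2-monsky-x PRE-ARM 36 053 members `< 3·10⁶` = the `k = 2` slice of DOOR B6
outside C6 exactly (it adds no row beyond DOOR B6; it replaces {Monsky-1994 even} by {Cor 5.15 (2′)} on them).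
Rank one in print (Monsky 1990); the `2`-part in no held print; proved here modulo the displayed facts.
A FAMILY of pairs in the OPEN cell `openO12` — not a class closure. Nothing booked; no mark moved.
Unit `b2b-bsdres-p2-typer` GEN 5; NEW file.

References: [TianYuanZhang2017] Thm 1.2, Thm 3.5, §3, §1 (1.1); [Monsky1990MockHeegner] Cor 5.15 (2′);
[LiMa2008] Lemma 0.1, Def 0.2, Thm 0.4; [IrelandRosen1990] Ch. 5 §§1–2; [SilvermanATAEC1994] IV.9
Table 4.1; [Knapp1993] Lemma 4.20; [Miller2011LMS] Def 1.1; HOME/p2/LEAD-OKS.md T-113 (O-1).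
-/

noncomputable section

open scoped Classical

open Matrix Finset WeierstrassCurve NumberField Literature.NumberTheory.EllipticCurves
  Literature.NumberTheory.EllipticCurves.Rank1Residual
  Literature.NumberTheory.EllipticCurves.Rank1Residual.Typed
  Literature.NumberTheory.EllipticCurves.Monsky1990
  Literature.NumberTheory.EllipticCurves.HeathBrown1994
  Literature.NumberTheory.EllipticCurves.TianYuanZhang2017
  Literature.NumberTheory.EllipticCurves.Tian2014
  Literature.NumberTheory.QuadraticFields.RedeiReichardt

set_option autoImplicit false

namespace Summit.BirchSwinnertonDyer.Rank1Residual.P2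

/-! ## §1 Rédei parities (mod RR): `g(2p₅)` odd; `g(p₅q₃)` even iff `(p/q) = 1`; `g(2p₅q₃)` odd;
`g(2p₅q₇)` even iff `(p/q) = 1` -/

section Redei

/-- The reciprocity bit between an odd prime `q` and a prime `p ≡ 1 (mod 4)`:
`[(D_q/p) = −1] = [(D_p/q) = −1] = [(p/q) = −1]` (any ambient `d`). [cite: LiMa2008, Lemma 0.1 and Def. 0.2 (p. 279)]
[cite: IrelandRosen1990, Ch. 5 §2 Thm. 1] -/
theorem kroneckerBit_primeDisc_eq_of_mod_four_one {d p q : ℕ} (hp : p.Prime) (hq : q.Prime)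
    (hp4 : p % 4 = 1) (hq2 : q ≠ 2) (hne : p ≠ q) :
    kroneckerBit (primeDisc d q) p = kroneckerBit p q ∧
      kroneckerBit (primeDisc d p) q = kroneckerBit p q := by
  have hp2 : p ≠ 2 := by omega
  have hcp : chi4Bit p = 0 := by simp [chi4Bit, hp4]
  constructor
  · rw [kroneckerBit_primeDisc hq hp hq2 hp2 hne.symm, kroneckerBit_swap hq hp hq2 hp2 hne.symm, hcp]
    ring
  · rw [kroneckerBit_primeDisc hp hq hp2 hq2 hne, hcp]
    ring

/-- `kroneckerBit p q = [(p/q) = −1]` is `0` when `(p/q) = 1` and `1` when `(p/q) = −1` (distinct primes, `q`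
odd). [cite: IrelandRosen1990, Ch. 5 §1 Prop. 5.1.2] -/
theorem kroneckerBit_of_jacobiSym {p q : ℕ} (hp : p.Prime) (hq : q.Prime) (hq2 : q ≠ 2) (hne : p ≠ q) :
    (jacobiSym p q = 1 → kroneckerBit p q = 0) ∧ (jacobiSym p q = -1 → kroneckerBit p q = 1) := by
  rw [kroneckerBit_eq_bitOf hq hq2 (intCast_natCast_prime_ne_zero hp hq hne)]
  unfold bitOf
  constructor
  · intro h; rw [if_neg (by rw [h]; norm_num)]
  · intro h; rw [if_pos h]

/-- **`g(2p)` is ODD for a prime `p ≡ 5 (mod 8)`** (mod RR): `disc ℚ(√−2p) = −8p`, `D₂ = −8`, `D_p = p`;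
`(−8/p) = (−2/p) = −1` and `(p/2)`: `p ≡ 5 (mod 8)` ⟹ bit `1`; Rédei matrix `(1 1; 1 1)`, kernel `{0, 𝟙}`.
[cite: LiMa2008, Thm. 0.4 with Lemma 0.1] [cite: TianYuanZhang2017, §1 (g(d))] -/
theorem odd_genusClassNumber_genusField_two_mul_prime_five (hR : redeiReichardt_fourTwoCard_classGroup)
    {p : ℕ} (hp : p.Prime) (hp5 : p % 8 = 5) : Odd (genusClassNumber (GenusField (2 * p))) := by
  have hp2 : p ≠ 2 := by omega
  have hp4 : p % 4 = 1 := by omega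
  have hprod : ∏ i, (![2, p] : Fin 2 → ℕ) i = if (2 * p) % 4 = 1 then 2 * (2 * p) else 2 * p := by
    rw [if_neg (by omega)]; simp [Fin.prod_univ_two]
  have hinj : Function.Injective (![2, p] : Fin 2 → ℕ) := by
    intro i j h
    fin_cases i <;> fin_cases j <;> simp_all [hp2.symm]
  rw [odd_genusClassNumber_genusField_iff_card_ker hR (ι := Fin 2) ![2, p]
    (fun i => by fin_cases i <;> [exact Nat.prime_two; exact hp]) hinj hprod]
  have hb1 : kroneckerBit (primeDisc (2 * p) p) 2 = 1 := by
    rw [kroneckerBit_primeDisc_two hp hp2]; simp [chi8Bit, hp5]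
  have hb2 : kroneckerBit (primeDisc (2 * p) 2) p = 1 := by
    rw [primeDisc_two_mul_two_of_five hp5, kroneckerBit_neg_eight_eq_ite hp hp4, if_pos hp5]
  have e : (Matrix.of fun a b : Fin 2 =>
      if a = b then ∑ c ∈ univ.erase a, kroneckerBit (primeDisc (2 * p) ((![2, p] : Fin 2 → ℕ) c))
        ((![2, p] : Fin 2 → ℕ) a)
      else kroneckerBit (primeDisc (2 * p) ((![2, p] : Fin 2 → ℕ) b)) ((![2, p] : Fin 2 → ℕ) a)) =
      !![1, 1; 1, 1] := by
    ext a b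
    fin_cases a <;> fin_cases b <;> simp [hb1, hb2]
  rw [e]
  decide

/-- **`g(pq)` is EVEN for primes `p ≡ 5 (mod 8)`, `q ≡ 3 (mod 8)` with `(p/q) = 1`** (mod RR): `pq ≡ 7 (mod 8)`,
`disc = −pq`, `D_p = p`, `D_q = −q`; both off-diagonal Rédei bits are `[(p/q) = −1] = 0` (reciprocity with
`p ≡ 1 (mod 4)`), so the Rédei matrix vanishes and its kernel has `4` elements (`r₄ = 1`).
[cite: LiMa2008, Thm. 0.4 with Lemma 0.1] [cite: TianYuanZhang2017, §1 (g(d))] -/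
theorem not_odd_genusClassNumber_genusField_five_mul_three (hR : redeiReichardt_fourTwoCard_classGroup)
    {p q : ℕ} (hp : p.Prime) (hq : q.Prime) (hp5 : p % 8 = 5) (hq3 : q % 8 = 3) (hj : jacobiSym p q = 1) :
    ¬ Odd (genusClassNumber (GenusField (p * q))) := by
  have hp2 : p ≠ 2 := by omega
  have hq2 : q ≠ 2 := by omega
  have hp4 : p % 4 = 1 := by omega
  have hne : p ≠ q := fun h => by omega
  have hq4 : q % 4 = 3 := by omega
  have hpq4 : (p * q) % 4 = 3 := by rw [Nat.mul_mod, hp4, hq4]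
  have hprod : ∏ i, (![p, q] : Fin 2 → ℕ) i = if (p * q) % 4 = 1 then 2 * (p * q) else p * q := by
    rw [if_neg (by omega)]; simp [Fin.prod_univ_two]
  have hinj : Function.Injective (![p, q] : Fin 2 → ℕ) := by
    intro i j h
    fin_cases i <;> fin_cases j <;> simp_all [hne.symm]
  rw [odd_genusClassNumber_genusField_iff_card_ker hR (ι := Fin 2) ![p, q]
    (fun i => by fin_cases i <;> assumption) hinj hprod]
  obtain ⟨h1, h2⟩ := kroneckerBit_primeDisc_eq_of_mod_four_one (d := p * q) hp hq hp4 hq2 hne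
  have h0 : kroneckerBit p q = 0 := (kroneckerBit_of_jacobiSym hp hq hq2 hne).1 hj
  have hb1 : kroneckerBit (primeDisc (p * q) q) p = 0 := by rw [h1, h0]
  have hb2 : kroneckerBit (primeDisc (p * q) p) q = 0 := by rw [h2, h0]
  have e : (Matrix.of fun a b : Fin 2 =>
      if a = b then ∑ c ∈ univ.erase a, kroneckerBit (primeDisc (p * q) ((![p, q] : Fin 2 → ℕ) c))
        ((![p, q] : Fin 2 → ℕ) a)
      else kroneckerBit (primeDisc (p * q) ((![p, q] : Fin 2 → ℕ) b)) ((![p, q] : Fin 2 → ℕ) a)) =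
      !![0, 0; 0, 0] := by
    ext a b
    fin_cases a <;> fin_cases b <;> simp [hb1, hb2]
  rw [e]
  decide

/-- The Rédei data of `ℚ(√−2pq)` for primes `p ≡ 5 (mod 8)` and odd `q ≡ 3 (mod 4)`: the prime tuple
`(2, p, q)`, its product and injectivity, and the six off-diagonal bits of `RM(−8pq)` —
`r(2,p) = 1`, `r(2,q) = [q ≡ 3 (mod 8)]`, `r(p,2) = 1`, `r(p,q) = r(q,p) = [(p/q) = −1]`, `r(q,2) = [q ≡ 3 (mod 8)]`.
[cite: LiMa2008, Lemma 0.1 and Def. 0.2 (p. 279)] -/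
theorem redeiBits_two_mul_five_mul {p q : ℕ} (hp : p.Prime) (hq : q.Prime) (hp5 : p % 8 = 5)
    (hq4 : q % 4 = 3) :
    kroneckerBit (primeDisc (2 * (p * q)) p) 2 = 1 ∧
    kroneckerBit (primeDisc (2 * (p * q)) q) 2 = chi8Bit q ∧
    kroneckerBit (primeDisc (2 * (p * q)) 2) p = 1 ∧
    kroneckerBit (primeDisc (2 * (p * q)) q) p = kroneckerBit p q ∧
    kroneckerBit (primeDisc (2 * (p * q)) 2) q = chi8Bit q ∧
    kroneckerBit (primeDisc (2 * (p * q)) p) q = kroneckerBit p q := by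
  have hp2 : p ≠ 2 := by omega
  have hq2 : q ≠ 2 := by omega
  have hp4 : p % 4 = 1 := by omega
  have hne : p ≠ q := fun h => by omega
  have hpq4 : (p * q) % 4 = 3 := by rw [Nat.mul_mod, hp4, hq4]
  have hD2 : primeDisc (2 * (p * q)) 2 = 8 := primeDisc_two_mul_two_of_mod_four_three hpq4
  obtain ⟨h1, h2⟩ := kroneckerBit_primeDisc_eq_of_mod_four_one (d := 2 * (p * q)) hp hq hp4 hq2 hne
  refine ⟨?_, ?_, ?_, h1, ?_, h2⟩
  · rw [kroneckerBit_primeDisc_two hp hp2]; simp [chi8Bit, hp5]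
  · rw [kroneckerBit_primeDisc_two hq hq2]
  · rw [hD2]; exact kroneckerBit_eight_eq_one hp (Or.inr hp5)
  · rw [hD2]
    have hq8 : q % 8 = 3 ∨ q % 8 = 7 := by omega
    rcases hq8 with h3 | h7
    · rw [kroneckerBit_eight_eq_one hq (Or.inl h3)]; simp [chi8Bit, h3]
    · rw [kroneckerBit_eight_eq_zero hq (Or.inr h7)]; simp [chi8Bit, h7]

/-- **`g(2pq)` for primes `p ≡ 5 (mod 8)`, `q ≡ 3 (mod 4)`** (mod RR): the Rédei matrix `RM(−8pq)` on `(2, p, q)`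
is `(c+1, 1, c; 1, 1+a, a; c, a, c+a)` with `a = [(p/q) = −1]`, `c = [q ≡ 3 (mod 8)]`; its kernel has `2`
elements unless `a = 0` and `c = 0`. Hence: `g(2pq)` is ODD iff `q ≡ 3 (mod 8)` or `(p/q) = −1`.
[cite: LiMa2008, Thm. 0.4 with Lemma 0.1] [cite: TianYuanZhang2017, §1 (g(d))] -/
theorem odd_genusClassNumber_genusField_two_mul_five_mul_iff (hR : redeiReichardt_fourTwoCard_classGroup)
    {p q : ℕ} (hp : p.Prime) (hq : q.Prime) (hp5 : p % 8 = 5) (hq4 : q % 4 = 3) :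
    Odd (genusClassNumber (GenusField (2 * (p * q)))) ↔ (q % 8 = 3 ∨ kroneckerBit p q = 1) := by
  have hp2 : p ≠ 2 := by omega
  have hq2 : q ≠ 2 := by omega
  have hne : p ≠ q := fun h => by omega
  have hprod : ∏ i, (![2, p, q] : Fin 3 → ℕ) i =
      if (2 * (p * q)) % 4 = 1 then 2 * (2 * (p * q)) else 2 * (p * q) := by
    rw [if_neg (by omega)]; simp [Fin.prod_univ_three, mul_assoc]
  have hinj : Function.Injective (![2, p, q] : Fin 3 → ℕ) := by
    intro i j h
    fin_cases i <;> fin_cases j <;> simp_all [hp2.symm, hq2.symm, hne.symm]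
  rw [odd_genusClassNumber_genusField_iff_card_ker hR (ι := Fin 3) ![2, p, q]
    (fun i => by fin_cases i <;> [exact Nat.prime_two; exact hp; exact hq]) hinj hprod]
  obtain ⟨b2p, b2q, bp2, bpq, bq2, bqp⟩ := redeiBits_two_mul_five_mul hp hq hp5 hq4
  have e0 : (univ : Finset (Fin 3)).erase 0 = {1, 2} := by decide
  have e1 : (univ : Finset (Fin 3)).erase 1 = {0, 2} := by decide
  have e2 : (univ : Finset (Fin 3)).erase 2 = {0, 1} := by decide
  have e : (Matrix.of fun a b : Fin 3 =>
      if a = b then ∑ c ∈ univ.erase a, kroneckerBit (primeDisc (2 * (p * q)) ((![2, p, q] : Fin 3 → ℕ) c))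
        ((![2, p, q] : Fin 3 → ℕ) a)
      else kroneckerBit (primeDisc (2 * (p * q)) ((![2, p, q] : Fin 3 → ℕ) b)) ((![2, p, q] : Fin 3 → ℕ) a)) =
      !![1 + chi8Bit q, 1, chi8Bit q; 1, 1 + kroneckerBit p q, kroneckerBit p q;
        chi8Bit q, kroneckerBit p q, chi8Bit q + kroneckerBit p q] := by
    ext a b
    fin_cases a <;> fin_cases b <;>
      simp [-Finset.sum_erase_eq_sub, e0, e1, e2, b2p, b2q, bp2, bpq, bq2, bqp]
  rw [e]
  have hc : chi8Bit q = if q % 8 = 3 then 1 else 0 := by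
    unfold chi8Bit
    by_cases h3 : q % 8 = 3
    · rw [if_pos (Or.inl h3), if_pos h3]
    · rw [if_neg (by omega), if_neg h3]
  rcases (by decide : ∀ z : ZMod 2, z = 0 ∨ z = 1) (kroneckerBit p q) with ha | ha <;>
    by_cases h3 : q % 8 = 3
  · rw [ha, hc, if_pos h3]; simp only [h3, true_or, iff_true]; decide
  · rw [ha, hc, if_neg h3]; simp only [h3, false_or, zero_ne_one, iff_false]; decide
  · rw [ha, hc, if_pos h3]; simp only [h3, true_or, iff_true]; decide
  · rw [ha, hc, if_neg h3]; simp only [h3, false_or, iff_true]; decide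

end Redei

/-! ## §2 The PRINTED second genus sum `Σ₂′(2pq)` is ODD when `(p/q) = +1` -/

section GenusSum

/-- **`Σ₂′(2pq)` over `GenusField` is ODD** for primes `p ≡ 5 (mod 8)`, `q ≡ 3 (mod 4)` with `(p/q) = +1`
(mod RR). By `natCast_genusSum₂'_three` on `(2, p, q)`: `Σ₂′(2pq) ≡ g(2pq) + [q ≡ 3 (8)]·g(2)g(pq) +
[q ≡ 7 (8)]·g(q)g(2p) (mod 2)` (the patterns `pat₂ p (2q)`, `pat₃ 2 p q` fail); `q ≡ 3 (mod 8)`: `g(2pq)` odd,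
`g(pq)` even ⟹ odd; `q ≡ 7 (mod 8)`: `g(2pq)` even, `g(q)`, `g(2p)` odd ⟹ odd. (p2-monsky-x: parity
`= [(p/q) = +1]` on all 72 221 pairs `< 3·10⁶`, EVIDENCE.)
[cite: TianYuanZhang2017, Thm. 1.2 (the second sum, p0002 L121–L129); proof of Prop. 3.4 (p0016 L146)]
[cite: LiMa2008, Thm. 0.4] -/
theorem odd_genusSum₂'_genusField_two_mul_five_mul (hR : redeiReichardt_fourTwoCard_classGroup)
    {p q : ℕ} (hp : p.Prime) (hq : q.Prime) (hp5 : p % 8 = 5) (hq4 : q % 4 = 3) (hj : jacobiSym p q = 1) :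
    Odd (genusSum₂' (2 * (p * q)) fun d => genusClassNumber (GenusField d)) := by
  have hp2 : p ≠ 2 := by omega
  have hq2 : q ≠ 2 := by omega
  have hne : p ≠ q := fun h => by omega
  have h0 : kroneckerBit p q = 0 := (kroneckerBit_of_jacobiSym hp hq hq2 hne).1 hj
  have hpq4 : (p * q) % 4 = 3 := by rw [Nat.mul_mod, show p % 4 = 1 by omega, hq4]
  have h8' : (2 * p * q) % 8 = 5 ∨ (2 * p * q) % 8 = 6 ∨ (2 * p * q) % 8 = 7 := by
    rw [mul_assoc]; omega
  rw [← ZMod.natCast_eq_one_iff_odd, show 2 * (p * q) = 2 * p * q by ring,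
    natCast_genusSum₂'_three _ Nat.prime_two hp hq hp2.symm hq2.symm hne h8']
  -- the pattern bits
  have hb2 : pat₂ p (2 * q) = false := by
    rw [← pat₂_mod, hp5, show (2 * q) % 8 = 6 by omega]; decide
  have hb3 : pat₃ 2 p q = false := by
    rw [← pat₃_mod, hp5]
    rcases (show q % 8 = 3 ∨ q % 8 = 7 by omega) with h | h <;> rw [h] <;> decide
  -- the `g`-values mod 2
  have g2 : ((genusClassNumber (GenusField 2) : ℕ) : ZMod 2) = 1 :=
    (ZMod.natCast_eq_one_iff_odd).mpr (odd_genusClassNumber_two hR (GenusField 2)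
      (isQuadraticFieldOfSqrt_genusField (d := 2) (by norm_num)))
  have g2p : ((genusClassNumber (GenusField (2 * p)) : ℕ) : ZMod 2) = 1 :=
    (ZMod.natCast_eq_one_iff_odd).mpr (odd_genusClassNumber_genusField_two_mul_prime_five hR hp hp5)
  have gq : ((genusClassNumber (GenusField q) : ℕ) : ZMod 2) = 1 :=
    (ZMod.natCast_eq_one_iff_odd).mpr (odd_genusClassNumber_genusField_prime hR hq hq4)
  rcases (show q % 8 = 3 ∨ q % 8 = 7 by omega) with h3 | h7
  · have hb1 : pat₂ 2 (p * q) = true := by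
      rw [← pat₂_mod, show (p * q) % 8 = 7 by rw [Nat.mul_mod, hp5, h3]]; decide
    have hbq : pat₂ q (2 * p) = false := by
      rw [← pat₂_mod, h3, show (2 * p) % 8 = 2 by omega]; decide
    have g2pq : ((genusClassNumber (GenusField (2 * p * q)) : ℕ) : ZMod 2) = 1 := by
      rw [show 2 * p * q = 2 * (p * q) by ring]
      exact (ZMod.natCast_eq_one_iff_odd).mpr
        ((odd_genusClassNumber_genusField_two_mul_five_mul_iff hR hp hq hp5 hq4).mpr (Or.inl h3))
    have gpq : ((genusClassNumber (GenusField (p * q)) : ℕ) : ZMod 2) = 0 :=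
      (ZMod.natCast_eq_zero_iff_even).mpr (Nat.not_odd_iff_even.mp
        (not_odd_genusClassNumber_genusField_five_mul_three hR hp hq hp5 h3 hj))
    simp [hb1, hb2, hbq, hb3, g2pq, gpq, bitOf]
  · have hb1 : pat₂ 2 (p * q) = false := by
      rw [← pat₂_mod, show (p * q) % 8 = 3 by rw [Nat.mul_mod, hp5, h7]]; decide
    have hbq : pat₂ q (2 * p) = true := by
      rw [← pat₂_mod, h7, show (2 * p) % 8 = 2 by omega]; decide
    have g2pq : ((genusClassNumber (GenusField (2 * p * q)) : ℕ) : ZMod 2) = 0 := by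
      rw [show 2 * p * q = 2 * (p * q) by ring]
      refine (ZMod.natCast_eq_zero_iff_even).mpr (Nat.not_odd_iff_even.mp fun hodd => ?_)
      rcases (odd_genusClassNumber_genusField_two_mul_five_mul_iff hR hp hq hp5 hq4).mp hodd with h | h
      · omega
      · rw [h0] at h; exact zero_ne_one h
    simp [hb1, hb2, hbq, hb3, g2pq, gq, g2p, bitOf]

end GenusSum

/-! ## §3 The family theorem, U⁺ discharged -/

section Family

/-- `2k(2pq) − 2 − a(2pq) = 2` and `∏_ℓ c_ℓ(E_{2pq}) = 2⁶` for distinct odd primes `p, q` — the tuple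
instances of `twoExponent_two_mul_prod_eq` / `tamagawaProduct_congruentNumberCurve_two_mul_prod`.
[cite: TianYuanZhang2017, §1 (p0002 L63–L65)] [cite: SilvermanATAEC1994, IV.9 Table 4.1] -/
theorem twoExponent_tamagawa_two_mul_prime_mul {p q : ℕ} (hp : p.Prime) (hq : q.Prime) (hp2 : p ≠ 2)
    (hq2 : q ≠ 2) (hne : p ≠ q) :
    twoExponent (2 * (p * q)) = 2 ∧ (congruentNumberCurve (2 * (p * q))).tamagawaProduct = 2 ^ 6 := by
  have hpv : ∀ i, ((![p, q] : Fin 2 → ℕ) i).Prime := fun i => by fin_cases i <;> assumption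
  have hov : ∀ i, Odd ((![p, q] : Fin 2 → ℕ) i) := fun i => by
    fin_cases i
    · exact hp.odd_of_ne_two hp2
    · exact hq.odd_of_ne_two hq2
  have hiv : Function.Injective (![p, q] : Fin 2 → ℕ) := by
    intro i j h; fin_cases i <;> fin_cases j <;> simp_all [hne.symm]
  have hnv : ∏ i, (![p, q] : Fin 2 → ℕ) i = p * q := by simp [Fin.prod_univ_two]
  constructor
  · have h := twoExponent_two_mul_prod_eq _ hpv hov hiv
    rw [hnv] at h; rw [h]; norm_num
  · rw [tamagawaProduct_congruentNumberCurve_two_mul_prod _ hpv hov hiv (by rw [hnv])]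

/-- **THE EVEN HALF-FAMILY `2·p₅·q`, `q ≡ 3 (mod 4)`, `(p/q) = +1`, U⁺ DISCHARGED.** For primes `p ≡ 5 (mod 8)`,
`q ≡ 3 (mod 4)` with `(p/q) = +1`: `ord_{s=1} L(E_{2pq}, s) = 1` and `BSD(E_{2pq}, 2)`, modulo the displayed facts
`hTYZ` (TYZ §3, lit-1), `hGZK` (input of the U⁺ composition only), `hR` (Rédei–Reichardt), `h515` (Monsky 1990 Cor 5.15 (2′): `2p₅p₃`,
`2p₅p₇` — rank `1`, `#Sel₂ = 8`, `Ш[2^∞] = 0`) — nothing per-curve displayed. Route: `Σ₂′(2pq)` odd (§2) ⇒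
U⁺: `𝓛(2pq)` odd, `r_an = 1`, `L′ = 4·𝓛²·Ω·Reg` (`rankOneDatum_of_uPlus_six`; `2k − 2 = 2`) ⇒ D-CN-5 door
(`bsdp_two_congruentNumberCurve_iff_of_cor515`; no GZK, no Monsky-1994 matrix) ⇒ `2 = ord₂ 2⁶ − 4`
(Tamagawa p324736, torsion p323719 by name). The complementary half `(p/q) = −1` has `Σ₂′(2pq)` EVEN (§1) —
U⁺ is silent there. The uniform `k = 2` slice of DOOR B6 outside Tian's class-`6` family (p2-monsky-x:
36 053 members `< 3·10⁶`, EVIDENCE). [cite: TianYuanZhang2017, Thm. 1.2, Thm. 3.5 and §1 (1.1)]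
[cite: Monsky1990MockHeegner, Cor. 5.15 (2′) (p. 66)] [cite: Miller2011LMS, Def. 1.1 (arXiv:1010.2431 p. 3)] -/
theorem bsdp_two_congruentNumberCurve_two_mul_five_mul
    (hTYZ : tyz_genusPointData) (hGZK : rank_eq_analyticRank_of_analyticRank_le_one)
    (hR : redeiReichardt_fourTwoCard_classGroup) (h515 : cor515_rank_eq_one_and_card_selmerGroup_two)
    {p q : ℕ} (hp : p.Prime) (hq : q.Prime) (hp5 : p % 8 = 5) (hq4 : q % 4 = 3) (hj : jacobiSym p q = 1) :
    haveI := isElliptic_congruentNumberCurve (Nat.mul_ne_zero two_ne_zero (Nat.mul_ne_zero hp.ne_zero hq.ne_zero))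
    (congruentNumberCurve (2 * (p * q))).analyticRank = 1 ∧ BSDp (congruentNumberCurve (2 * (p * q))) 2 := by
  have hp2 : p ≠ 2 := by omega
  have hq2 : q ≠ 2 := by omega
  have hne : p ≠ q := fun h => by omega
  haveI := isElliptic_congruentNumberCurve (Nat.mul_ne_zero two_ne_zero (Nat.mul_ne_zero hp.ne_zero hq.ne_zero))
  haveI : Fact (Nat.Prime 2) := ⟨Nat.prime_two⟩
  have hq8 : q % 8 = 3 ∨ q % 8 = 7 := by omega
  have hN : IsCor515Family (2 * (p * q)) :=
    Or.inr (Or.inr (Or.inr (Or.inl ⟨p, q, hp, hq, hp5, hq8, rfl⟩)))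
  have hsq : Squarefree (2 * (p * q)) := hN.squarefree
  have h6 : (2 * (p * q)) % 8 = 6 := by
    have : (p * q) % 4 = 3 := by rw [Nat.mul_mod, show p % 4 = 1 by omega, hq4]
    omega
  -- U⁺ + `Σ₂′` odd: `𝓛` odd, `ord = 1`, `L′ = 2^e · 𝓛² · Ω · Reg`
  obtain ⟨Lz, hLodd, hr1, hderiv⟩ := rankOneDatum_of_uPlus_six (uPlus_of_genusPointData hTYZ hGZK) hsq h6
    (odd_genusSum₂'_genusField_two_mul_five_mul hR hp hq hp5 hq4 hj)
  have hx : deriv (congruentNumberCurve (2 * (p * q))).entireLFunction 1 =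
      (((2 : ℚ) ^ twoExponent (2 * (p * q)) * (Lz : ℚ) ^ 2 : ℚ) : ℂ) *
        ((congruentNumberCurve (2 * (p * q))).realPeriodRat : ℂ) *
          ((congruentNumberCurve (2 * (p * q))).regulator : ℂ) := by
    rw [hderiv]; push_cast; ring
  have hx0 : (2 : ℚ) ^ twoExponent (2 * (p * q)) * (Lz : ℚ) ^ 2 ≠ 0 := by
    have hL0' : Lz ≠ 0 := fun h => by simp [h] at hLodd
    have hL0 : (Lz : ℚ) ≠ 0 := by exact_mod_cast hL0'
    exact mul_ne_zero (zpow_ne_zero _ two_ne_zero) (pow_ne_zero _ hL0)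
  obtain ⟨he, htam⟩ := twoExponent_tamagawa_two_mul_prime_mul hp hq hp2 hq2 hne
  obtain ⟨-, hiff⟩ := bsdp_two_congruentNumberCurve_iff_of_cor515 h515 hN
    (torsionOrder_congruentNumberCurve hsq) hx0 hx
  refine ⟨hr1, hiff.mpr ?_⟩
  rw [padicValRat_two_zpow_mul_sq hLodd, he, htam, padicValNat.prime_pow]
  norm_num

/-- **`BSD(E_{2pq}, 2)` for ALL primes `p ≡ 5 (mod 8)`, `q ≡ 3 (mod 4)` with `(p/q) = +1`, U⁺ DISCHARGED**,
modulo `hTYZ`, `hGZK`, `hR`, `h515`; no per-curve input. [cite: TianYuanZhang2017, Thm. 1.2, Thm. 3.5 and §1 (1.1)]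
[cite: Monsky1990MockHeegner, Cor. 5.15 (2′) (p. 66)] [cite: Miller2011LMS, Def. 1.1 (arXiv:1010.2431 p. 3)] -/
theorem forall_bsdp_two_congruentNumberCurve_two_mul_five_mul
    (hTYZ : tyz_genusPointData) (hGZK : rank_eq_analyticRank_of_analyticRank_le_one)
    (hR : redeiReichardt_fourTwoCard_classGroup) (h515 : cor515_rank_eq_one_and_card_selmerGroup_two) :
    ∀ p q : ℕ, p.Prime → q.Prime → p % 8 = 5 → q % 4 = 3 → jacobiSym p q = 1 →
      BSDp (congruentNumberCurve (2 * (p * q))) 2 :=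
  fun _ _ hp hq hp5 hq4 hj => (bsdp_two_congruentNumberCurve_two_mul_five_mul hTYZ hGZK hR h515 hp hq hp5 hq4 hj).2

end Family

end Summit.BirchSwinnertonDyer.Rank1Residual.P2

end
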